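import Literature.Computability.Cryptography.SamplingProblems
import Literature.Computability.Cryptography.StatisticalDistanceProofs
import Literature.Computability.Complexity.PolyTimeCountable
import Literature.Computability.Complexity.CodeFPArith
import Literature.Computability.Complexity.TM2PassThrough
import HarnessLib

/-!
# `SampBQP` is countable, the tree's `SampP` is not: `SampP ≠ SampBQP`

Companion of `SamplingProblems.lean` (the classes `SampP`, `SampBQP`; Aaronson–Arkhipov 2013,
Def. 2.3 / Aaronson 2011, §2) and `SamplingProblemsUniform.lean` (the corrected class
`UniformSampP` and the proved inclusion `UniformSampP ⊆ SampBQP`). The module docstring of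
`SamplingProblems.lean` records that the vendored named fact
`SampP_subset_SampBQP : SampP ⊆ SampBQP` is **mis-stated — false as formalised**, because the
tree's `SampP` quantifies over `RandAlg`s with `IsPPT A id`, which only *bounds* the coin budget
`A.coinLen : ℕ → ℕ` by a polynomial (otherwise arbitrary data, readable by `A.run` off the length
of its coin string), whereas the source's `SampBPP` (Aaronson–Chen 2017, Def. 2.3: "a
probabilistic polynomial-time algorithm `B`") is a class of *uniform* machines. This file turns
that remark into theorems, by a counting argument that needs no computability theory of
amplitudes:

* `sampBQP_countable` — **`SampBQP` is a countable set**: a member is pinned down by its witness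
  (a uniform Clifford+T family `F` and a polynomial-time post-processing `post`: two laws within
  `1/k` of the same kernels for every `k` are equal, `PMF.eq_of_tvDist_eq_zero`), and there are
  countably many witnesses (`countable_setOf_polyTimeComputable` of `PolyTimeCountable.lean`,
  through `countable_setOf_isUniform`);
* `exists_injective_forall_mem_sampP` — for every `h : ℕ → Bool` the point-mass problem
  `x ↦ δ_{[h(|bin |x||)]}` (`Nat.size |x|`, the number of binary digits of `|x|`) lies in the
  tree's `SampP`, injectively in `h`: the sampler has coin budget
  `coinLen n = ∑_{i < size n} [h i]·2ⁱ ≤ 2n` and the *fixed*, genuinely polynomial-time program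
  `⟨⟨x, 1ᵏ⟩, r⟩ ↦ [bit_{size |x|} |r|]` (typed in the `CodeFP` algebra of `CodeFP.lean` /
  `CodeFPArith.lean`; `size |x| < size |⟨x, 1ᵏ⟩|`, so the bit is always present);
* `not_countable_sampP`, **`sampP_ne_sampBQP : SampP ≠ SampBQP`**, `not_sampP_subset_sampBQP`, and
  the refutation `not_SampP_subset_SampBQP : ¬ SampP_subset_SampBQP` of the vendored fact.

Consequence recorded for the barrier catalogue (`Literature/Barriers/QuantumAdvantage/PPolyOracles*.lean`):
every named fact of the tree whose hypothesis is the literal equality `SampP = SampBQP`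
(Aaronson–Chen 2017, Thm. 8.1 / Lemma 8.2 as vendored: `aaronsonChen2017_thm81`,
`aaronsonChen2017_lem82`, `aaronsonChen2017_lem82_machine`) holds VACUOUSLY; the faithful
hypothesis is `UniformSampP = SampBQP` (equivalently `SampBQP ⊆ UniformSampP`, by
`UniformSampP_subset_SampBQP_holds`).

## References

* S. Aaronson, A. Arkhipov, *The computational complexity of linear optics*, Theory of Computing 9
  (2013), Def. 2.3 (p. 162) (`SampP`, `SampBQP`).
* S. Aaronson, L. Chen, *Complexity-theoretic foundations of quantum supremacy experiments*,
  CCC 2017 (arXiv:1612.05903), Def. 2.3 (p. 12: "a probabilistic polynomial-time algorithm"),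
  Thm. 8.1 and Lemma 8.2 (p. 32).
* S. Arora, B. Barak, *Computational Complexity: A Modern Approach*, CUP 2009, §1.4 (machines as
  strings: countably many machines), §6.3 / Def. 6.5 (advice), §7.1 (coins of a PTM).

## Design notes

* No definitions are introduced: the advice-taking sampler is an anonymous `RandAlg` inside the
  proofs (`isPPT_adviceSampler`, `samplePMF_adviceSampler` state its two properties for any string
  function `f` and budget `c`), so that nothing here can be mistaken for a vendored notion.
* `PMF.eq_of_tvDist_eq_zero` is a deliberate dot-notation extension of Mathlib's `PMF` namespace,
  next to `PMF.tvDist` of `StatisticalDistance.lean`.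
-/

namespace Literature.Computability.Cryptography

open _root_.Computability Literature.Computability.Complexity

/-! ### Statistical distance zero -/

/-- Laws at statistical distance `0` are equal (`Δ(p, q) = ½ ∑ |p − q|` is a sum of nonnegative
terms). Deliberate dot-notation extension of Mathlib's `PMF` namespace. [folklore] -/
theorem _root_.PMF.eq_of_tvDist_eq_zero {α : Type*} {p q : PMF α} (h : p.tvDist q = 0) : p = q := by
  have hsum : ∑' a, |(p a).toReal - (q a).toReal| = 0 := by
    have h2 : (2 : ℝ)⁻¹ * ∑' a, |(p a).toReal - (q a).toReal| = 0 := h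
    simpa using h2
  have hs : HasSum (fun a => |(p a).toReal - (q a).toReal|) 0 := by
    rw [← hsum]
    exact (PMF.summable_abs_toReal_sub_toReal p q).hasSum
  have hf : (fun a => |(p a).toReal - (q a).toReal|) = 0 :=
    (hasSum_zero_iff_of_nonneg fun a => abs_nonneg _).1 hs
  refine PMF.ext fun a => ?_
  have ha : |(p a).toReal - (q a).toReal| = 0 := congrFun hf a
  rw [abs_eq_zero, sub_eq_zero] at ha
  exact (ENNReal.toReal_eq_toReal_iff' (PMF.apply_ne_top p a) (PMF.apply_ne_top q a)).1 ha

/-- Two laws each within `1/k` of a common law `w k`, for every `k ≥ 1`, are equal. [folklore] -/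
theorem _root_.PMF.eq_of_forall_tvDist_le_inv {α : Type*} {p q : PMF α} (w : ℕ → PMF α)
    (hp : ∀ k : ℕ, 0 < k → (w k).tvDist p ≤ 1 / (k : ℝ))
    (hq : ∀ k : ℕ, 0 < k → (w k).tvDist q ≤ 1 / (k : ℝ)) : p = q := by
  apply PMF.eq_of_tvDist_eq_zero
  refine le_antisymm ?_ (PMF.tvDist_nonneg _ _)
  have hk : ∀ k : ℕ, 0 < k → p.tvDist q ≤ 2 / (k : ℝ) := by
    intro k hk
    calc p.tvDist q ≤ p.tvDist (w k) + (w k).tvDist q := PMF.tvDist_triangle_holds _ _ _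
      _ ≤ 1 / (k : ℝ) + 1 / (k : ℝ) := add_le_add (by rw [PMF.tvDist_comm]; exact hp k hk) (hq k hk)
      _ = 2 / (k : ℝ) := by ring
  by_contra hle
  have hlt : 0 < p.tvDist q := not_le.1 hle
  obtain ⟨k, hk'⟩ := exists_nat_gt (2 / p.tvDist q)
  have hkr : (0 : ℝ) < k := lt_trans (by positivity) hk'
  have hkpos : 0 < k := by exact_mod_cast hkr
  have h1 := hk k hkpos
  rw [div_lt_iff₀ hlt] at hk'
  rw [le_div_iff₀ hkr] at h1
  linarith

/-! ### `SampBQP` is countable -/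

/-- **There are countably many uniform Clifford+T circuit families**: a uniform family is
determined by the polynomial-time function `1ⁿ ↦ ⟨n, ancillas n, circ n⟩` it is described by
(`sigmaEncode` is injective), and polynomial-time computable functions form a countable set
(`countable_setOf_polyTimeComputable`). [cite: AroraBarak2009, §1.4] -/
theorem countable_setOf_isUniform : Set.Countable {F : QCircuitFamily cliffordT | F.IsUniform} := by
  have h := countable_setOf_polyTimeComputable (α := ℕ) (β := Σ n m : ℕ, QCircuit cliffordT (n + m))
    unaryEncodeNat (eb := QCircuit.sigmaEncode (G := cliffordT)) QCircuit.sigmaEncode_injective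
  refine Set.MapsTo.countable_of_injOn
    (f := fun F : QCircuitFamily cliffordT => fun n =>
      (⟨n, F.ancillas n, F.circ n⟩ : Σ n m : ℕ, QCircuit cliffordT (n + m)))
    (fun F hF => hF) ?_ h
  rintro ⟨a, c⟩ - ⟨a', c'⟩ - hFF
  have key : ∀ n, a n = a' n ∧ HEq (c n) (c' n) := fun n => by
    have := congrFun hFF n
    simpa using this
  obtain rfl : a = a' := funext fun n => (key n).1
  simp only [heq_eq_eq] at key
  obtain rfl : c = c' := funext fun n => (key n).2
  rfl

/-- **`SampBQP` is a countable set of sampling problems**: it is covered by the sets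
`{D | ∀ x k, Δ((F.samplePMF x k).map post, D x) ≤ 1/k}` over the countably many witnesses
`(F, post)` — `F` a uniform family (`countable_setOf_isUniform`), `post` polynomial-time
(`countable_setOf_polyTimeComputable`) — and each of these sets has at most one element
(`PMF.eq_of_forall_tvDist_le_inv`). [cite: AroraBarak2009, §1.4] -/
theorem sampBQP_countable : SampBQP.Countable := by
  have hU := countable_setOf_isUniform
  have hV : Set.Countable {post : List Bool → List Bool | PolyTimeComputable id id post} :=
    countable_setOf_polyTimeComputable (α := List Bool) (β := List Bool) id (eb := id)
      Function.injective_id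
  have hT : ∀ (F : QCircuitFamily cliffordT) (post : List Bool → List Bool),
      Set.Subsingleton {D : SamplingProblem | ∀ (x : List Bool) (k : ℕ), 0 < k →
        ((F.samplePMF x k).map post).tvDist (D x) ≤ 1 / (k : ℝ)} := by
    intro F post D hD D' hD'
    funext x
    exact PMF.eq_of_forall_tvDist_le_inv (fun k => (F.samplePMF x k).map post)
      (fun k hk => hD x k hk) (fun k hk => hD' x k hk)
  refine (hU.biUnion fun F _ => hV.biUnion fun post _ => (hT F post).countable).mono ?_
  rintro D ⟨F, post, -, hF, hpost, happrox⟩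
  exact Set.mem_biUnion hF (Set.mem_biUnion hpost happrox)

/-! ### The tree's `SampP` is uncountable: samplers with advice in the coin budget -/

/-- The binary number with digits `h 0, …, h (B-1)` is below `2^B`. [folklore] -/
theorem sum_ite_two_pow_lt (h : ℕ → Bool) (B : ℕ) :
    (∑ i ∈ Finset.range B, if h i then 2 ^ i else 0) < 2 ^ B := by
  induction B with
  | zero => simp
  | succ B ih =>
    rw [Finset.sum_range_succ, pow_succ]
    split_ifs <;> omega

/-- Its `j`-th binary digit is `h j` (`j < B`). [folklore] -/
theorem testBit_sum_ite_two_pow (h : ℕ → Bool) {B j : ℕ} (hj : j < B) :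
    Nat.testBit (∑ i ∈ Finset.range B, if h i then 2 ^ i else 0) j = h j := by
  induction B with
  | zero => omega
  | succ B ih =>
    rw [Finset.sum_range_succ]
    rcases Nat.lt_succ_iff_lt_or_eq.1 hj with hlt | rfl
    · by_cases hB : h B = true
      · rw [if_pos hB, add_comm, Nat.testBit_two_pow_add_gt hlt, ih hlt]
      · rw [if_neg hB, add_zero, ih hlt]
    · have hlow := Nat.testBit_lt_two_pow (sum_ite_two_pow_lt h j)
      by_cases hB : h j = true
      · rw [if_pos hB, add_comm, Nat.testBit_two_pow_add_eq, hlow, hB]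
        rfl
      · rw [if_neg hB, add_zero, hlow]
        exact (Bool.eq_false_iff.2 hB).symm

/-- The first component of a pair has fewer binary digits of length than the pair:
`size |x| < size |⟨x, u⟩|` (`|⟨x, u⟩| = 2|x| + 2 + |u|`). [folklore] -/
theorem size_length_lt_size_length_boolPair (x u : List Bool) :
    Nat.size x.length < Nat.size (boolPair x u).length := by
  rw [length_boolPair]
  rcases Nat.eq_zero_or_pos x.length with h0 | hpos
  · rw [h0, Nat.size_zero]
    exact Nat.size_pos.2 (by omega)
  · apply Nat.lt_size.2
    have hs : 0 < Nat.size x.length := Nat.size_pos.2 hpos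
    have h1 : 2 ^ (Nat.size x.length - 1) ≤ x.length := Nat.lt_size.1 (by omega)
    have h2 : 2 ^ Nat.size x.length = 2 * 2 ^ (Nat.size x.length - 1) := by
      rw [← pow_succ']
      congr 1
      omega
    omega

/-- **The read-out program is polynomial time**: some `f ∈ FP` maps `⟨⟨x, 1ᵏ⟩, r⟩` to the bit
`bit_{size |x|} |r|` of the length of the coin string — typed in the `CodeFP` algebra
(`strNatLength`, `strOfNat`, `strLength`, `natPow`, `natDiv`, `natMod`, `natEq`), with
`bit_j c = [c / 2ʲ mod 2 = 1]` and `size a = |bin a|`. [cite: AroraBarak2009, §1.2–1.3 (closure of polynomial time under composition)] -/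
theorem exists_readBit_mem_FP : ∃ f ∈ FP, ∀ (x : List Bool) (k : ℕ) (r : List Bool),
    f (boolPair (boolPair x (unaryEncodeNat k)) r) = [Nat.testBit r.length (Nat.size x.length)] := by
  have hx : CodeFP (CodeFP.pairE (CodeFP.pairE CodeFP.strE CodeFP.unE) CodeFP.strE) CodeFP.strE
      (fun t : (List Bool × ℕ) × List Bool => t.1.1) :=
    (CodeFP.fst _ _).fst'
  have ha : CodeFP (CodeFP.pairE (CodeFP.pairE CodeFP.strE CodeFP.unE) CodeFP.strE) CodeFP.natE
      (fun t : (List Bool × ℕ) × List Bool => t.1.1.length) :=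
    CodeFP.strNatLength.comp hx
  have hj : CodeFP (CodeFP.pairE (CodeFP.pairE CodeFP.strE CodeFP.unE) CodeFP.strE) CodeFP.unE
      (fun t : (List Bool × ℕ) × List Bool => (CodeFP.natE t.1.1.length).length) :=
    CodeFP.strLength.comp (CodeFP.strOfNat.comp ha)
  have hpw : CodeFP (CodeFP.pairE (CodeFP.pairE CodeFP.strE CodeFP.unE) CodeFP.strE) CodeFP.natE
      (fun t : (List Bool × ℕ) × List Bool => 2 ^ (CodeFP.natE t.1.1.length).length) :=
    CodeFP.natPow.comp ((CodeFP.const (eβ := CodeFP.natE) _ (2 : ℕ)).pair hj)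
  have hc : CodeFP (CodeFP.pairE (CodeFP.pairE CodeFP.strE CodeFP.unE) CodeFP.strE) CodeFP.natE
      (fun t : (List Bool × ℕ) × List Bool => t.2.length) :=
    CodeFP.strNatLength.comp (CodeFP.snd _ _)
  have hq : CodeFP (CodeFP.pairE (CodeFP.pairE CodeFP.strE CodeFP.unE) CodeFP.strE) CodeFP.natE
      (fun t : (List Bool × ℕ) × List Bool =>
        t.2.length / 2 ^ (CodeFP.natE t.1.1.length).length % 2) :=
    CodeFP.natMod.comp ((CodeFP.natDiv.comp (hc.pair hpw)).pair
      (CodeFP.const (eβ := CodeFP.natE) _ (2 : ℕ)))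
  have hP : CodeFP (CodeFP.pairE (CodeFP.pairE CodeFP.strE CodeFP.unE) CodeFP.strE) CodeFP.bitE
      (fun t : (List Bool × ℕ) × List Bool =>
        decide (t.2.length / 2 ^ (CodeFP.natE t.1.1.length).length % 2 = 1)) :=
    CodeFP.natEq.comp (hq.pair (CodeFP.const (eβ := CodeFP.natE) _ (1 : ℕ)))
  obtain ⟨f, hf, hspec⟩ := hP
  refine ⟨f, hf, fun x k r => ?_⟩
  have h1 := hspec ((x, k), r)
  simp only [CodeFP.pairE_apply, CodeFP.strE, CodeFP.unE, id] at h1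
  rw [h1, Nat.testBit_eq_decide_div_mod_eq, CodeFP.bitE]
  simp [CodeFP.natE, TM2Pass.length_encodeNat_eq_size]

/-- **An advice-taking sampler is `IsPPT`**: the algorithm `run y r := f ⟨y, r⟩` with ANY coin
budget `c` bounded by a polynomial is probabilistic polynomial-time in the sense of
`RandAlg.IsPolyTime` as soon as `f ∈ FP` — the coin budget is data, not computed.
[cite: AroraBarak2009, §7.1 (coins of a PTM) and Def. 6.5 (advice)] -/
theorem isPPT_adviceSampler {f : List Bool → List Bool} (hf : f ∈ FP) {c : ℕ → ℕ}
    (p : Polynomial ℕ) (hc : ∀ n, c n ≤ p.eval n) :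
    IsPPT (⟨fun y r => f (boolPair y r), c⟩ : RandAlg (List Bool) (List Bool)) id := by
  refine ⟨?_, p, hc⟩
  have h := (CodeFP.of_fn (eα := CodeFP.pairE CodeFP.strE CodeFP.strE) (eβ := CodeFP.strE)
    (g := fun q : List Bool × List Bool => f (boolPair q.1 q.2)) f hf (fun _ => rfl)).polyTimeComputable
  exact h

/-- A push-forward of the uniform coin distribution along a map that is constant on coin strings
of the prescribed length is the point mass. [folklore] -/
theorem map_uniformVector_eq_pure {β : Type} {m : ℕ} (g : List Bool → β) (b : β)
    (hg : ∀ r : List Bool, r.length = m → g r = b) :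
    (PMF.uniformOfFintype (List.Vector Bool m)).map (fun r => g r.toList) = PMF.pure b := by
  have : (fun r : List.Vector Bool m => g r.toList) = Function.const _ b :=
    funext fun r => hg r.toList r.toList_length
  rw [this, PMF.map_const]

/-- **The law of the advice-taking sampler**: with the read-out program of
`exists_readBit_mem_FP` and the coin budget `c n = ∑_{i < size n} [h i] 2ⁱ`, on `⟨x, 1ᵏ⟩` the
sampler outputs `[h (size |x|)]` surely (bit `size |x| < size |⟨x, 1ᵏ⟩|` of the coin count).
[cite: AroraBarak2009, Def. 6.5 (advice)] -/
theorem samplePMF_adviceSampler {f : List Bool → List Bool}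
    (hf : ∀ (x : List Bool) (k : ℕ) (r : List Bool),
      f (boolPair (boolPair x (unaryEncodeNat k)) r) = [Nat.testBit r.length (Nat.size x.length)])
    (h : ℕ → Bool) (x : List Bool) (k : ℕ) :
    (⟨fun y r => f (boolPair y r),
        fun n => ∑ i ∈ Finset.range (Nat.size n), if h i then 2 ^ i else 0⟩ :
        RandAlg (List Bool) (List Bool)).samplePMF x k = PMF.pure [h (Nat.size x.length)] := by
  unfold RandAlg.samplePMF RandAlg.outputPMF
  refine map_uniformVector_eq_pure _ _ fun r hr => ?_
  dsimp only
  rw [hf, hr, id, testBit_sum_ite_two_pow h (size_length_lt_size_length_boolPair x _)]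

/-- **Uncountably many sampling problems lie in the tree's `SampP`**: `h ↦ (x ↦ δ_{[h (size |x|)]})`
is injective (every `j` is `size |x|` for some `x`: `size 0 = 0`, `size 2ʲ = j + 1`) and each of
these point-mass problems is sampled EXACTLY by the advice-taking sampler with coin budget
`∑_{i < size n} [h i] 2ⁱ ≤ 2n` (`isPPT_adviceSampler`, `samplePMF_adviceSampler`) — the coin
budget of `RandAlg.IsPolyTime` is only bounded, not computed, so it can carry the advice `h`.
[cite: AroraBarak2009, Def. 6.5 (advice) and §7.1] -/
theorem exists_injective_forall_mem_sampP :
    ∃ D : (ℕ → Bool) → SamplingProblem, Function.Injective D ∧ ∀ h, D h ∈ SampP := by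
  obtain ⟨f, hf, hspec⟩ := exists_readBit_mem_FP
  refine ⟨fun h x => PMF.pure [h (Nat.size x.length)], ?_, fun h => ?_⟩
  · intro h h' hh
    funext j
    obtain ⟨x, hx⟩ : ∃ x : List Bool, Nat.size x.length = j := by
      rcases j with _ | j
      · exact ⟨[], by simp⟩
      · exact ⟨List.replicate (2 ^ j) false, by rw [List.length_replicate, Nat.size_pow]⟩
    have h1 := congrFun hh x
    simp only at h1
    rw [hx] at h1
    have h2 := congrArg (fun p : PMF (List Bool) => p [h j]) h1
    simp only [PMF.pure_apply, if_true] at h2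
    by_contra hne
    rw [if_neg (fun e => hne (List.cons.inj e).1)] at h2
    exact one_ne_zero h2
  · refine ⟨⟨fun y r => f (boolPair y r),
      fun n => ∑ i ∈ Finset.range (Nat.size n), if h i then 2 ^ i else 0⟩,
      isPPT_adviceSampler hf (2 * Polynomial.X + 1) fun n => ?_, fun x k _ => ?_⟩
    · -- the budget: `∑_{i < size n} [h i] 2ⁱ < 2^{size n} ≤ 2n + 1`
      simp only [Polynomial.eval_add, Polynomial.eval_mul, Polynomial.eval_ofNat,
        Polynomial.eval_X, Polynomial.eval_one]
      have hsz : 2 ^ Nat.size n ≤ 2 * n + 1 := by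
        rcases Nat.eq_zero_or_pos n with rfl | hpos
        · simp
        · have hs : 0 < Nat.size n := Nat.size_pos.2 hpos
          have h1 : 2 ^ (Nat.size n - 1) ≤ n := Nat.lt_size.1 (by omega)
          have h2 : 2 ^ Nat.size n = 2 * 2 ^ (Nat.size n - 1) := by
            rw [← pow_succ']
            congr 1
            omega
          omega
      exact (sum_ite_two_pow_lt h _).le.trans hsz
    · rw [samplePMF_adviceSampler hspec h x k, PMF.tvDist_self]
      positivity

/-- **The tree's `SampP` is not countable**: it contains the injective image of `ℕ → Bool`
(`exists_injective_forall_mem_sampP`), into which `Set ℕ` injects, and an injection of `Set ℕ`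
into a countable type contradicts Cantor's theorem (`Function.cantor_injective`).
[cite: AroraBarak2009, Def. 6.5 (advice)] -/
theorem not_countable_sampP : ¬ SampP.Countable := by
  intro hc
  obtain ⟨D, hinj, hmem⟩ := exists_injective_forall_mem_sampP
  have hr : (Set.range D).Countable := hc.mono (by rintro _ ⟨h, rfl⟩; exact hmem h)
  haveI := hr.to_subtype
  haveI : Countable (ℕ → Bool) :=
    Function.Injective.countable (f := fun h => (⟨D h, h, rfl⟩ : Set.range D))
      fun h h' hh => hinj (congrArg Subtype.val hh)
  classical
  have hind : Function.Injective (fun S : Set ℕ => fun n => decide (n ∈ S)) := by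
    intro S T hST
    ext n
    simpa using congrFun hST n
  haveI : Countable (Set ℕ) := hind.countable
  obtain ⟨g, hg⟩ := Countable.exists_injective_nat (Set ℕ)
  exact Function.cantor_injective g hg

/-- **`SampP ≠ SampBQP` over the tree's definitions**: `SampBQP` is countable
(`sampBQP_countable`), the advice-taking `SampP` is not (`not_countable_sampP`). Hence every
statement of the tree with hypothesis `SampP = SampBQP` holds vacuously; the faithful rendering of
"`SampBPP = SampBQP`" (Aaronson–Chen 2017, Def. 2.3, p. 12: uniform machines) is
`UniformSampP = SampBQP` (`SamplingProblemsUniform.lean`). [cite: AroraBarak2009, Def. 6.5 (advice) and §1.4] -/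
theorem sampP_ne_sampBQP : SampP ≠ SampBQP := fun h =>
  not_countable_sampP (h ▸ sampBQP_countable)

/-- `SampP ⊄ SampBQP` over the tree's definitions (a countable set contains no uncountable one).
[cite: AroraBarak2009, Def. 6.5 (advice) and §1.4] -/
theorem not_sampP_subset_sampBQP : ¬ (SampP ⊆ SampBQP) := fun h =>
  not_countable_sampP (sampBQP_countable.mono h)

/-- **Refutation of the vendored named fact `SampP_subset_SampBQP`** (flagged "mis-stated — false
as formalised" in its docstring; the corrected statement `UniformSampP_subset_SampBQP` is proved in
`SamplingProblemsUniform.lean`). [cite: AaronsonArkhipovToC2013, Def. 2.3 (p. 162)] -/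
theorem not_SampP_subset_SampBQP : ¬ SampP_subset_SampBQP :=
  not_sampP_subset_sampBQP

end Literature.Computability.Cryptography
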